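import Literature.Analysis.ValidatedNumerics.TaylorModelExp
import HarnessLib

/-!
# Taylor model of `e^{λρ}` with an INTERVAL rate, and the three-term lower bound

`texpMI S h K Λ` encloses `ρ ↦ e^{λρ}` on `|ρ| ≤ h` for every real `λ ∈ Λ` (interval coefficients
`Λ^k/k!`, Lagrange remainder `|λh|^K (K+1)/(K!·K)` bounded through `|λ| ≤ absHi Λ / S`), extending
`texpI` (rational rate) of `TaylorModelExp`; needed when the rate is a logarithm known only as an
interval (e.g. `u^{ρ/2} = e^{ρ·ln u/2}`). `lower3_le`: for `θ ∈ [0,1]` and Taylor models `P₀ ∋ G₀`,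
`P₁ ∋ G₁`, `P₂ ∋ G₂`, the number `tlowerI P₀ + min 0 (tlowerI P₁) + min 0 (tlowerI P₂)` bounds
`S·(G₀(ρ) + θ G₁(ρ) + θ² G₂(ρ))` from below. Folklore validated numerics (Makino–Berz Taylor models).
-/

namespace Literature.Analysis.ValidatedNumerics

namespace PolyMP

open Literature.Analysis.ValidatedNumerics.NumericsMP

/-! ### Interval powers -/

/-- `Λ^k` by repeated outward products. [folklore] -/
def mpow (S : ℕ) (Λ : MI) : ℕ → MI
  | 0 => MI.ofInt S 1
  | k + 1 => MI.mul S (mpow S Λ k) Λ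

/-- [folklore] -/
theorem mem_mpow {S : ℕ} (hS : 0 < S) {lam : ℝ} {Λ : MI} (hΛ : MI.mem S lam Λ) :
    ∀ k, MI.mem S (lam ^ k) (mpow S Λ k)
  | 0 => by simpa [mpow] using MI.mem_ofInt S 1
  | k + 1 => by rw [pow_succ]; exact MI.mem_mul hS (mem_mpow hS hΛ k) hΛ

/-! ### The exponential with interval rate -/

/-- Coefficients `Λ^k/k!`, `k < K`. [folklore] -/
def texpCoeffsMI (S : ℕ) (Λ : MI) (K : ℕ) : IPoly :=
  (List.range K).map fun k => (mpow S Λ k).divNat k.factorial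

/-- Scaled remainder `⌈S · (Bh)^K (K+1)/(K!·K)⌉` with `B = absHi Λ / S ≥ |λ|`. [folklore] -/
def texpRemMI (S : ℕ) (h : ℚ) (Λ : MI) (K : ℕ) : ℤ :=
  ⌈(S : ℚ) * (((Λ.absHi : ℚ) / S * h) ^ K * ((K + 1 : ℚ) / ((K.factorial : ℚ) * K)))⌉

/-- The Taylor model of `ρ ↦ e^{λρ}`, `λ ∈ Λ`, on `|ρ| ≤ h`. [folklore] -/
def texpMI (S : ℕ) (h : ℚ) (K : ℕ) (Λ : MI) : IPoly :=
  widen0 (texpCoeffsMI S Λ K) (texpRemMI S h Λ K)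

/-- **Soundness of `texpMI`.** For `0 < S`, `0 < K` and `(absHi Λ / S)·h ≤ 1`, every `λ ∈ Λ`
has `e^{λρ} ∈ texpMI` on `|ρ| ≤ h`. [folklore] -/
theorem tmem_expMI {S : ℕ} (hS : 0 < S) {h : ℚ} {K : ℕ} (hK : 0 < K) {lam : ℝ} {Λ : MI}
    (hΛ : MI.mem S lam Λ) (hBh : (Λ.absHi : ℚ) / S * h ≤ 1) :
    TMem S h (fun ρ => Real.exp (lam * ρ)) (texpMI S h K Λ) := by
  intro ρ hρ
  set as : List ℝ := (List.range K).map fun k => lam ^ k / (k.factorial : ℝ) with has_def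
  have has : PMem S as (texpCoeffsMI S Λ K) :=
    pmem_map (fun k => by
      have := MI.mem_divNat (mem_mpow hS hΛ k) (Nat.factorial_pos k)
      simpa using this) _
  have hSR : (0 : ℝ) < S := by exact_mod_cast hS
  -- |λ| ≤ B := absHi/S
  set B : ℝ := (Λ.absHi : ℝ) / S with hB
  have hlamB : |lam| ≤ B := by
    rw [hB, le_div_iff₀ hSR]; exact MI.abs_le_absHi hΛ
  have hB0 : 0 ≤ B := (abs_nonneg _).trans hlamB
  have hBh' : B * (h : ℝ) ≤ 1 := by
    have := (Rat.cast_le (K := ℝ)).2 hBh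
    push_cast at this
    simpa [hB] using this
  have hx : |lam * ρ| ≤ B * h := by
    rw [abs_mul]; exact mul_le_mul hlamB hρ (abs_nonneg _) hB0
  have hx1 : |lam * ρ| ≤ 1 := hx.trans hBh'
  have hrem := Real.exp_bound hx1 hK
  set R : ℝ := Real.exp (lam * ρ) - ∑ m ∈ Finset.range K, (lam * ρ) ^ m / m.factorial with hR
  have hc : (0 : ℝ) ≤ (K.succ : ℝ) / ((K.factorial : ℝ) * K) := by positivity
  have h1 : |R| ≤ (B * h) ^ K * ((K.succ : ℝ) / ((K.factorial : ℝ) * K)) :=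
    hrem.trans (mul_le_mul_of_nonneg_right (pow_le_pow_left₀ (abs_nonneg _) hx K) hc)
  have h2 : ((S : ℚ) * (((Λ.absHi : ℚ) / S * h) ^ K * ((K + 1 : ℚ) / ((K.factorial : ℚ) * K))) : ℝ) ≤
      (texpRemMI S h Λ K : ℝ) := by
    unfold texpRemMI; exact_mod_cast Int.le_ceil _
  have hRle : |R| * S ≤ (texpRemMI S h Λ K : ℝ) := by
    refine le_trans ?_ h2
    calc |R| * S ≤ (B * h) ^ K * ((K.succ : ℝ) / ((K.factorial : ℝ) * K)) * S :=
          mul_le_mul_of_nonneg_right h1 hSR.le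
      _ = ((S : ℚ) * (((Λ.absHi : ℚ) / S * h) ^ K * ((K + 1 : ℚ) / ((K.factorial : ℚ) * K))) : ℝ) := by
          rw [hB]; push_cast; ring
  obtain ⟨bs, hbs, hev⟩ := exists_widen0 has hRle ρ
  refine ⟨bs, hbs, ?_⟩
  rw [hev, has_def, evalR_map_range, hR]
  have : ∀ m ∈ Finset.range K, (lam * ρ) ^ m / m.factorial = lam ^ m / (m.factorial : ℝ) * ρ ^ m := by
    intro m _; rw [mul_pow]; ring
  rw [Finset.sum_congr rfl this]
  ring

/-! ### The three-term lower bound in an auxiliary parameter `θ ∈ [0,1]` -/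

/-- `tlowerI P₀ + min 0 (tlowerI P₁) + min 0 (tlowerI P₂)`. [folklore] -/
def lower3 (S : ℕ) (h : ℚ) (P0 P1 P2 : IPoly) : ℤ :=
  tlowerI S h P0 + min 0 (tlowerI S h P1) + min 0 (tlowerI S h P2)

/-- For `θ ∈ [0,1]`: `lower3 ≤ S·(G₀(ρ) + θ G₁(ρ) + θ² G₂(ρ))`. [folklore] -/
theorem lower3_le {S : ℕ} {h : ℚ} (h0 : 0 ≤ h) {G0 G1 G2 : ℝ → ℝ} {P0 P1 P2 : IPoly}
    (hG0 : TMem S h G0 P0) (hG1 : TMem S h G1 P1) (hG2 : TMem S h G2 P2)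
    {θ : ℝ} (hθ0 : 0 ≤ θ) (hθ1 : θ ≤ 1) {ρ : ℝ} (hρ : |ρ| ≤ h) :
    (lower3 S h P0 P1 P2 : ℝ) ≤ (G0 ρ + θ * G1 ρ + θ ^ 2 * G2 ρ) * S := by
  have e0 := tlowerI_le h0 hG0 hρ
  have e1 := tlowerI_le h0 hG1 hρ
  have e2 := tlowerI_le h0 hG2 hρ
  have hθ2 : θ ^ 2 ≤ 1 := by nlinarith
  have hθ2' : 0 ≤ θ ^ 2 := by positivity
  -- `min 0 t ≤ c·t'` whenever `t ≤ t'` and `c ∈ [0,1]`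
  have key : ∀ (t : ℤ) (x c : ℝ), (t : ℝ) ≤ x → 0 ≤ c → c ≤ 1 → ((min 0 t : ℤ) : ℝ) ≤ c * x := by
    intro t x c ht hc0 hc1
    by_cases hx : 0 ≤ x
    · have : ((min 0 t : ℤ) : ℝ) ≤ 0 := by exact_mod_cast min_le_left 0 t
      exact this.trans (mul_nonneg hc0 hx)
    · have : ((min 0 t : ℤ) : ℝ) ≤ t := by exact_mod_cast min_le_right 0 t
      have hx' : x < 0 := lt_of_not_ge hx
      nlinarith
  have k1 := key _ _ _ e1 hθ0 hθ1
  have k2 := key _ _ _ e2 hθ2' hθ2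
  simp only [lower3, Int.cast_add]
  nlinarith

end PolyMP

end Literature.Analysis.ValidatedNumerics
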